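import Summits.QuantumFields.YangMills.Theorems.IR.TensionRatioRP
import HarnessLib

/-!
# Crux `IR` (stmt-QuantumFields-19354), line `tension-ratio`: the registered rung T2-sc REDUCED to ONE typed input —
`ratioStrongCoupling_of_loopFloorSC : LoopFloorSC → RatioStrongCoupling`

Helper module for item `stmt-QuantumFields-19354` (`--supports … --as helper`; it closes nothing).  The registered rung stub
`TensionRatio.stub_rung_ratioStrongCoupling : RatioStrongCoupling` (skeleton v1.5 `Cruxes/IR/Lines/ym_ir7_tension_ratio.lean`; T2-sc:
ONE ratio constant `c` on ALL of `(0, β_D]`, general centre-charged `π`, area law on the line's ODD tori `2S+1`) was priced (card v1.6) as needing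
(a) a RATE-TRACKING strong-coupling cold pressure bound and (b) an a-priori LOWER bound on the `π`-loops capping the admissible area-law rate.
(a) is LANDED (`StrongCouplingRate.coldPressureBound_strongCoupling_log`, p600923: rate `(1 + log(r_ρ/β))/8`).  This file proves, in the kernel,
that (b) in the typed form `LoopFloorSC` (`Theorems/IR/TensionRatioDefs.lean` §6: `(w β^k)^{n²} ≤ |⟨χ_π(W_{n×n})⟩_{2S+1}|` on all large odd tori,
`β ∈ (0, βL]`, `n ≥ 1`) is ALL that is left:  `LoopFloorSC → RatioStrongCoupling` (hence `→ RatioStrongCouplingWindow` by the landed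
`ratioStrongCouplingWindow_of_ratioStrongCoupling`).

**Proof.**  `βD = min βL r_ρ`; the β-INDEPENDENT bookkeeping `κ₀ = −k(1 + log r_ρ) − log w`, `A = (k + 1) + max κ₀ 0`, `c = 1/(8√A)`.
For `β ∈ (0, βD]` put `τ = 1 + log(r_ρ/β) ≥ 1`; an area law `(C, s)` on all large odd tori and the floor at `R = T = n` on a common large torus
give `(wβ^k)^{n²} ≤ (|C|+1)^{4n} e^{−s n²}` for all `n ≥ 1`, so `s ≤ −log(wβ^k) = kτ + κ₀ ≤ A·τ` (`rate_le_neg_log_of_areaLaw`); then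
`c√s ≤ √(Aτ)/(8√A) ≤ τ/8` (`τ ≥ 1`) and input (a) at rate `τ/8` on every torus, lowered by `coldPressureBound_mono_rate`, is the conclusion.

HONEST FRAMING: a kernel-checked REDUCTION of a FORMAT rung inside `IR`'s known regime to one typed strong-coupling input (`LoopFloorSC`, TRUE and
standard — Osterwalder–Seiler 1978 §5 ∕ Seiler 1978 — but not in the tree on odd tori ∕ for general `π`: the surface expansion); nothing is
discharged about `TensionFloor` ∕ `RatioFloorSC`; not consumed by `IR_of`; the YM mass gap (Clay) is NOT proved; `R4` closes only the conditional
rung `BalabanLadder.UV`.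
-/

set_option autoImplicit false

noncomputable section

open MeasureTheory Filter Topology
open Literature.MathematicalPhysics Literature.MathematicalPhysics.QuantumFieldTheory Literature.MathematicalPhysics.QuantumLattice
open Literature.MathematicalPhysics.QuantumFieldTheory.Balaban1983to89.Sufficient (ColdPressureBound)
open Literature.MathematicalPhysics.QuantumFieldTheory.Balaban1983to89.Missing (strongCouplingRadius strongCouplingRadius_pos)
open Summit.QuantumFields.YangMills.Cruxes.IR.ColdPressurePincer
open Summit.QuantumFields.YangMills.Cruxes.IR.StrongCouplingRate (coldPressureBound_strongCoupling_log)

namespace Summit.QuantumFields.YangMills.Cruxes.IR.TensionRatio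

/-! ## §1 Arithmetic of the uniform constant with an exponent `k` -/

/-- **The uniform ratio constant, exponent `k`.**  If `ℓ = k·τ + κ₀`, `τ ≥ 1`, `A = (k + 1) + max κ₀ 0` and `s ≤ ℓ`, then
`(1/(8√A))·√s ≤ τ/8`. -/
theorem sqrt_rate_le_of_log_pow {s ℓ τ κ₀ : ℝ} {k : ℕ} (hτ : 1 ≤ τ) (hℓ : ℓ = (k : ℝ) * τ + κ₀) (hsl : s ≤ ℓ) :
    1 / (8 * Real.sqrt (((k : ℝ) + 1) + max κ₀ 0)) * Real.sqrt s ≤ τ / 8 := by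
  set A : ℝ := ((k : ℝ) + 1) + max κ₀ 0 with hA
  have hm0 : 0 ≤ max κ₀ 0 := le_max_right _ _
  have hk0 : (0 : ℝ) ≤ k := Nat.cast_nonneg k
  have hA1 : 1 ≤ A := by rw [hA]; linarith
  have hA0 : 0 < A := lt_of_lt_of_le one_pos hA1
  have hsA : 0 < Real.sqrt A := Real.sqrt_pos.2 hA0
  have hτ0 : 0 ≤ τ := le_trans zero_le_one hτ
  -- `s ≤ ℓ ≤ A τ`
  have hℓA : ℓ ≤ A * τ := by
    rw [hℓ, hA]
    have h1 : κ₀ ≤ max κ₀ 0 := le_max_left _ _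
    nlinarith
  have hsq : Real.sqrt s ≤ Real.sqrt A * τ :=
    calc Real.sqrt s ≤ Real.sqrt (A * τ) := Real.sqrt_le_sqrt (hsl.trans hℓA)
      _ = Real.sqrt A * Real.sqrt τ := Real.sqrt_mul hA0.le τ
      _ ≤ Real.sqrt A * τ := mul_le_mul_of_nonneg_left (sqrt_le_self_of_one_le hτ) hsA.le
  calc 1 / (8 * Real.sqrt A) * Real.sqrt s ≤ 1 / (8 * Real.sqrt A) * (Real.sqrt A * τ) :=
        mul_le_mul_of_nonneg_left hsq (by positivity)
    _ = τ / 8 := by field_simp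

/-! ## §2 The reduction -/

/-- **T2-sc from the loop floor (real proof): `LoopFloorSC → RatioStrongCoupling`.**  With `(βL, k, w)` from the floor and
`r_ρ = strongCouplingRadius r.ρ`: `βD = min βL r_ρ`, `κ₀ = −k(1 + log r_ρ) − log w`, `c = 1/(8√((k+1) + max κ₀ 0))` serve every `β ∈ (0, βD]` —
the area law `(C, s)` on all large odd tori and the floor at `R = T = n` cap `s ≤ −log(wβ^k) = k(1 + log(r_ρ/β)) + κ₀`, and input (a)
(`coldPressureBound_strongCoupling_log`, rate `(1 + log(r_ρ/β))/8 ≥ c√s`) is the asserted cold trace bound on every odd torus. -/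
theorem ratioStrongCoupling_of_loopFloorSC (hLF : LoopFloorSC) : RatioStrongCoupling := by
  intro G _ _ _ _ hG hsc
  letI : MeasurableSpace G := borel G
  haveI : BorelSpace G := ⟨rfl⟩
  intro r N π z ω hN hπ hz hω hπz
  haveI : SecondCountableTopology G :=
    (r.continuous.isClosedEmbedding r.injective).isEmbedding.secondCountableTopology
  obtain ⟨βL, hβL, k, w, hw0, hfloor⟩ := hLF G hG hsc r N π z ω hN hπ hz hω hπz
  have hR0 := strongCouplingRadius_pos r.ρ
  obtain ⟨κ₀, hκ₀⟩ : ∃ κ₀ : ℝ, κ₀ = -(k : ℝ) * (1 + Real.log (strongCouplingRadius r.ρ)) - Real.log w := ⟨_, rfl⟩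
  refine ⟨1 / (8 * Real.sqrt (((k : ℝ) + 1) + max κ₀ 0)), ?_, min βL (strongCouplingRadius r.ρ), lt_min hβL hR0,
    fun β hβ0 hββD s hs C hAL => ?_⟩
  · have : 0 < ((k : ℝ) + 1) + max κ₀ 0 := by
      have h1 := le_max_right κ₀ 0
      have h2 : (0 : ℝ) ≤ k := Nat.cast_nonneg k
      linarith
    positivity
  have hβL' : β ≤ βL := hββD.trans (min_le_left _ _)
  have hβR : β ≤ strongCouplingRadius r.ρ := hββD.trans (min_le_right _ _)
  obtain ⟨S₂, hS₂⟩ := hAL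
  -- (i) the rate cap `s ≤ -log (w β^k)` from the floor and the area law on a common large odd torus
  have hwβ0 : 0 < w * β ^ k := mul_pos hw0 (pow_pos hβ0 k)
  have hcap : s ≤ -Real.log (w * β ^ k) := by
    refine rate_le_neg_log_of_areaLaw hwβ0 (D := |C| + 1) (by linarith [abs_nonneg C]) (n₀ := 1) fun n hn => ?_
    obtain ⟨S₀, hS₀⟩ := hfloor β hβ0 hβL' n hn
    have hF := hS₀ (max (max S₂ S₀) n) ((le_max_right _ _).trans (le_max_left _ _))
    have hA := hS₂ (max (max S₂ S₀) n) ((le_max_left _ _).trans (le_max_left _ _)) n n hn hn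
      (le_max_right _ _) (le_max_right _ _)
    calc (w * β ^ k) ^ (n * n) ≤ |torusRect r.ρ (fun g => normalisedCharacter N (π g)) β (max (max S₂ S₀) n) n n| := hF
      _ ≤ C ^ (2 * (n + n)) * Real.exp (-(s * n * n)) := hA
      _ ≤ (|C| + 1) ^ (2 * (n + n)) * Real.exp (-(s * n * n)) := by
          refine mul_le_mul_of_nonneg_right ?_ (Real.exp_pos _).le
          calc C ^ (2 * (n + n)) ≤ |C ^ (2 * (n + n))| := le_abs_self _
            _ = |C| ^ (2 * (n + n)) := abs_pow _ _
            _ ≤ (|C| + 1) ^ (2 * (n + n)) := pow_le_pow_left₀ (abs_nonneg _) (by linarith) _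
  -- (ii) input (a): cold pressure at rate `τ/8`, `τ = 1 + log(r_ρ/β)`, on every torus
  obtain ⟨τ, hτdef⟩ : ∃ τ : ℝ, τ = 1 + Real.log (strongCouplingRadius r.ρ / β) := ⟨_, rfl⟩
  have hq : 1 ≤ strongCouplingRadius r.ρ / β := by rw [le_div_iff₀ hβ0, one_mul]; exact hβR
  have hτ : 1 ≤ τ := by have := Real.log_nonneg hq; rw [hτdef]; linarith
  have hcp : ∀ S : ℕ, ColdPressureBound r.ρ β S (τ / 8) (28311552 * Real.exp 28311552) := fun S => by
    rw [hτdef]; exact coldPressureBound_strongCoupling_log r hβ0 hβR S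
  -- (iii) `-log (w β^k) = k τ + κ₀`
  have hℓ : -Real.log (w * β ^ k) = (k : ℝ) * τ + κ₀ := by
    rw [hτdef, hκ₀, Real.log_mul hw0.ne' (pow_pos hβ0 k).ne', Real.log_pow, Real.log_div hR0.ne' hβ0.ne']
    ring
  refine ⟨28311552 * Real.exp 28311552, by positivity, 0, fun S _ => coldPressureBound_mono_rate (hcp S) (by positivity) ?_⟩
  exact sqrt_rate_le_of_log_pow hτ hℓ hcap

/-- **Corollary: the loop floor also gives the window rung T2-sc-window** (by the landed `ratioStrongCouplingWindow_of_ratioStrongCoupling`). -/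
theorem ratioStrongCouplingWindow_of_loopFloorSC (hLF : LoopFloorSC) : RatioStrongCouplingWindow :=
  ratioStrongCouplingWindow_of_ratioStrongCoupling (ratioStrongCoupling_of_loopFloorSC hLF)

end Summit.QuantumFields.YangMills.Cruxes.IR.TensionRatio

end
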